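import Mathlib
import Literature.NumberTheory.LFunctions.Zhang2022.Section15U009Tail
import HarnessLib

/-!
# Zhang (2022) §15 u009 (p. 80, tex L4037), first half: the head `Σ_{m≤P²}` — moving the segment
# `𝔍(−1)` to the critical segment `𝔍(0)`

Topic `Literature/NumberTheory/LFunctions/Zhang2022` (Landau–Siegel audit tree; verdict-neutral).
Y. Zhang, *Discrete mean estimates and the Landau–Siegel zero*, arXiv:2211.02515v1 (2022)
[Zhang2022LandauSiegel] — **an unrefereed manuscript under adjudication; nothing here asserts or
denies its Theorems 1–2.** ZHANG-L discharge lane (helper under leaf `Typed.Section15A.Eq15_6`, node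
`Z22:§15.u009`, via the tree edge `eq15_4_of`); THEOREM-ONLY.

§15 p. 80 (tex L4037): "In a way similar to the proof of (7.3) …". The §15 mirror image of the tree's
`Typed.Sec14.Eq143.shift` ((14.3)/(7.3): "we move the path of integration to `𝔍(0)`", §7 p. 35): for
every `ψ ∈ Ψ`, the `𝔍(−1)`-integral of the HEAD part
`F(s) = ψ̄(D)D^{−(1−s)}·(Σ_{m≤⌊P²⌋} k̃(m)ψ̄(m)m^{−(1−s)})·B(s,ψ)·ω(s)` (entire) of the u008 integrand satisfies
`‖∫_{𝔍(−1)} F‖ ≤ ∫_{𝔍(0)} |F(s)||ds| + C·e^{−𝓛¹⁰/16}`: Cauchy's theorem on the rectangle with vertical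
sides `𝔍(−1)`, `𝔍(0)` (`Section7aStatements.norm_intJ_sub_intJ_le`), and on the horizontal sides
`|D^{−(1−s)}| ≤ 1`, `|head| ≤ ⌊P²⌋⁴` (`norm_ktilde_head_le_crude`), `|B| ≤ C_b⌈PT⁻²⌉³`
(`norm_Bpoly_le_of_neg_half_le_re`), `|ω| ≤ 2e^{1/4}e^{−𝓛¹⁰/4}` (`norm_omegaW_side_le_left`), against
`P¹¹e^{−𝓛¹⁰/4} ≤ e^{−𝓛¹⁰/16}` (`𝓛 ≥ 64`).

## References

* Y. Zhang, arXiv:2211.02515v1 (2022), §15 p. 80, tex L4037; §7 p. 35, tex L1893–L1899; §2 (2.15).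
  [cite: Zhang2022LandauSiegel, §15 p. 80]
-/

noncomputable section

open Complex Real MeasureTheory Set intervalIntegral
open scoped ComplexConjugate

namespace Literature.NumberTheory.LFunctions.Zhang2022.Typed.Section15A.U009

open Skeleton Section7aStatements Section7Eq73Edge

variable (c' : ℝ) {D : ℕ}

/-- Budget of the horizontal sides: `⌊P²⌋⁴·⌈PT⁻²⌉³·e^{−𝓛¹⁰/4} ≤ e^{−𝓛¹⁰/16}` for `𝓛 ≥ 64`
(`⌊P²⌋ ≤ P²`, `⌈PT⁻²⌉ ≤ P`, `P¹¹ = e^{11𝓛⁹}`, `11𝓛⁹ ≤ 3𝓛¹⁰/16`). [folklore] -/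
private theorem side_budget {D : ℕ} (hℓ : 64 ≤ ell D) :
    (⌊bigP D ^ 2⌋₊ : ℝ) ^ 4 * (⌈bigP D / bigT D ^ 2⌉₊ : ℝ) ^ 3 * Real.exp (-(ell D ^ 10 / 4)) ≤
      Real.exp (-(1 / 16) * ell D ^ 10) := by
  have hℓ1 : 1 ≤ ell D := le_trans (by norm_num) hℓ
  have hP0 : 0 < bigP D := Real.exp_pos _
  have hX : (⌊bigP D ^ 2⌋₊ : ℝ) ≤ bigP D ^ 2 := Nat.floor_le (by positivity)
  have hN : (⌈bigP D / bigT D ^ 2⌉₊ : ℝ) ≤ bigP D := ceil_PT2_le_bigP (by linarith)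
  have h11 : bigP D ^ 11 = Real.exp (11 * ell D ^ 9) := by rw [bigP, ← Real.exp_nat_mul]; norm_num
  have h10 : ell D ^ 10 = ell D * ell D ^ 9 := by ring
  have h9 : 1 ≤ ell D ^ 9 := one_le_pow₀ hℓ1
  have hm : 64 * ell D ^ 9 ≤ ell D * ell D ^ 9 := mul_le_mul_of_nonneg_right hℓ (by linarith)
  calc (⌊bigP D ^ 2⌋₊ : ℝ) ^ 4 * (⌈bigP D / bigT D ^ 2⌉₊ : ℝ) ^ 3 * Real.exp (-(ell D ^ 10 / 4))
      ≤ (bigP D ^ 2) ^ 4 * bigP D ^ 3 * Real.exp (-(ell D ^ 10 / 4)) := by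
        gcongr
    _ = Real.exp (11 * ell D ^ 9) * Real.exp (-(ell D ^ 10 / 4)) := by rw [← h11]; ring
    _ = Real.exp (11 * ell D ^ 9 - ell D ^ 10 / 4) := by rw [← Real.exp_add]; ring_nf
    _ ≤ Real.exp (-(1 / 16) * ell D ^ 10) := Real.exp_le_exp.mpr (by rw [h10]; linarith)

/-- `2πt₀ − 𝓛₁ > 0` for `𝓛 ≥ 1`. [folklore] -/
private theorem twoPiT0_sub_ell1_pos' {D : ℕ} (hℓ : 1 ≤ ell D) : 0 < 2 * π * t0 D - ell1 D := by
  have h1 : ell D ^ 405 ≤ ell D ^ 519 := pow_le_pow_right₀ hℓ (by norm_num)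
  have h2 : 1 ≤ ell D ^ 519 := one_le_pow₀ hℓ
  rw [t0, ell1]; nlinarith [Real.pi_gt_three]

/-- **The §15.u009 mirror of `Z22:§7.u018`** ("we move the path of integration to `𝔍(0)`", §7 p. 35):
eventually in `D`, for every `ψ ∈ Ψ`, with `F(s) = ψ̄(D)D^{−(1−s)}(Σ_{m≤⌊P²⌋}k̃(m)ψ̄(m)m^{−(1−s)})B(s,ψ)ω(s)`,
`‖∫_{𝔍(−1)} F(s)ds‖ ≤ ∫_{𝔍(0)} |F(s)||ds| + 4e^{1/4}C_b·e^{−𝓛¹⁰/16}` (`C_b = (1+|ι₂|)(|ι₃|+|ι₄|)`).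
[cite: Zhang2022LandauSiegel, §15 p. 80, tex L4037; §7 p. 35, tex L1894] -/
theorem shift (c' : ℝ) : ∃ C : ℝ, ForAllLarge fun D _ χ => ∀ x : Chr D,
    ‖intJ D (-1) (fun s => conj (x.ψ (D : ZMod x.p)) * (D : ℂ) ^ (-(1 - s)) *
        (∑ m ∈ Finset.Icc 1 ⌊bigP D ^ 2⌋₊,
          ktilde c' D m * conj (x.ψ (m : ZMod x.p)) * (m : ℂ) ^ (-(1 - s))) *
        Bpoly χ x s * omegaW D s)‖ ≤
      absIntJ D 0 (fun s => conj (x.ψ (D : ZMod x.p)) * (D : ℂ) ^ (-(1 - s)) *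
        (∑ m ∈ Finset.Icc 1 ⌊bigP D ^ 2⌋₊,
          ktilde c' D m * conj (x.ψ (m : ZMod x.p)) * (m : ℂ) ^ (-(1 - s))) *
        Bpoly χ x s * omegaW D s) +
      C * Real.exp (-(1 / 16) * ell D ^ 10) := by
  obtain ⟨D₁, hD₁⟩ := exists_nat_forall_le_ell 64
  set Cb : ℝ := (1 + ‖iota2‖) * (‖iota3‖ + ‖iota4‖) with hCbdef
  have hCb0 : 0 ≤ Cb := by positivity
  refine ⟨4 * Real.exp (1 / 4) * Cb, max 3 D₁, fun D _ χ hD _ _ x => ?_⟩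
  have hD3 : 3 ≤ D := le_trans (le_max_left _ _) hD
  have hD0 : 0 < D := by omega
  have hD1 : (1 : ℝ) ≤ D := by exact_mod_cast (show 1 ≤ D by omega)
  have hℓ64 : 64 ≤ ell D := hD₁ D (le_trans (le_max_right _ _) hD)
  have hℓ : 1 ≤ ell D := by linarith
  have hℓ0 : 0 < ell D := by linarith
  have hℓ3 : 3 ≤ ell D := by linarith
  have hℓ9 : 1 ≤ ell D ^ 9 := one_le_pow₀ hℓ
  have hL0 : 0 ≤ ell1 D := by rw [ell1]; positivity
  have hside : 0 < 2 * π * t0 D - ell1 D := twoPiT0_sub_ell1_pos' hℓ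
  -- the integrand and its holomorphy (entire)
  set Hf : ℂ → ℂ := fun w =>
    ∑ m ∈ Finset.Icc 1 ⌊bigP D ^ 2⌋₊, ktilde c' D m * conj (x.ψ (m : ZMod x.p)) * (m : ℂ) ^ (-w) with hHf
  set F : ℂ → ℂ := fun s => conj (x.ψ (D : ZMod x.p)) * (D : ℂ) ^ (-(1 - s)) * Hf (1 - s) *
    Bpoly χ x s * omegaW D s with hF
  have hHd : Differentiable ℂ Hf := differentiable_ktilde_head c' x _
  have hFd : Differentiable ℂ F := by
    have h1 : Differentiable ℂ (fun s : ℂ => (D : ℂ) ^ (-(1 - s))) := fun s =>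
      DifferentiableAt.const_cpow (by fun_prop) (Or.inl (Nat.cast_ne_zero.mpr hD0.ne'))
    have h2 : Differentiable ℂ (fun s : ℂ => Hf (1 - s)) :=
      hHd.comp ((differentiable_const _).sub differentiable_id)
    exact ((((differentiable_const _).mul h1).mul h2).mul
      (Typed.Section17.differentiable_Bpoly χ x)).mul (differentiable_omegaW D)
  have hdiff : DifferentiableOn ℂ F (Set.uIcc (1 / 2 + (-1 : ℝ)) (1 / 2 + (0 : ℝ)) ×ℂ
      Set.uIcc (2 * π * t0 D - ell1 D) (2 * π * t0 D + ell1 D)) := hFd.differentiableOn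
  -- the horizontal sides `t = 2πt₀ + v`, `v = ±𝓛₁`, `−1/2 ≤ σ ≤ 1/2`
  set M : ℝ := (⌊bigP D ^ 2⌋₊ : ℝ) ^ 4 * (Cb * (⌈bigP D / bigT D ^ 2⌉₊ : ℝ) ^ 3) *
    (2 * Real.exp (1 / 4) * Real.exp (-(ell D ^ 10 / 4))) with hMdef
  have hM : ∀ u ∈ Set.Icc (1 / 2 + (-1 : ℝ)) (1 / 2 + (0 : ℝ)), ∀ v : ℝ, v ^ 2 = ell1 D ^ 2 →
      ‖F ((u : ℂ) + ((2 * π * t0 D + v : ℝ) : ℂ) * I)‖ ≤ M := by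
    intro u hu v hv
    have hu0 : -1 / 2 ≤ u := by linarith [hu.1]
    have hu1 : u ≤ 1 / 2 := by linarith [hu.2]
    set s : ℂ := (u : ℂ) + ((2 * π * t0 D + v : ℝ) : ℂ) * I with hs
    have hsre : s.re = u := by simp [hs]
    have hψ : ‖conj (x.ψ (D : ZMod x.p))‖ ≤ 1 := by
      rw [Complex.norm_conj]; exact DirichletCharacter.norm_le_one _ _
    have hDpow : ‖(D : ℂ) ^ (-(1 - s))‖ ≤ 1 := by
      rw [Complex.norm_natCast_cpow_of_pos hD0]
      refine Real.rpow_le_one_of_one_le_of_nonpos hD1 ?_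
      simp only [neg_re, sub_re, one_re, hsre]; linarith
    have hH : ‖Hf (1 - s)‖ ≤ (⌊bigP D ^ 2⌋₊ : ℝ) ^ 4 :=
      norm_ktilde_head_le_crude c' x hℓ0 _ (by simp only [sub_re, one_re, hsre]; linarith)
    have hB : ‖Bpoly χ x s‖ ≤ Cb * (⌈bigP D / bigT D ^ 2⌉₊ : ℝ) ^ 3 :=
      norm_Bpoly_le_of_neg_half_le_re χ x hℓ3 (by rw [hsre]; exact hu0)
    have hω : ‖omegaW D s‖ ≤ 2 * Real.exp (1 / 4) * Real.exp (-(ell D ^ 10 / 4)) :=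
      norm_omegaW_side_le_left hD3 (by linarith) hu1 hv
    have hX0 : 0 ≤ (⌊bigP D ^ 2⌋₊ : ℝ) ^ 4 := pow_nonneg (Nat.cast_nonneg _) 4
    have hK1 : 0 ≤ Cb * (⌈bigP D / bigT D ^ 2⌉₊ : ℝ) ^ 3 := by positivity
    have e0 : ‖conj (x.ψ (D : ZMod x.p))‖ * ‖(D : ℂ) ^ (-(1 - s))‖ ≤ 1 :=
      (mul_le_mul hψ hDpow (norm_nonneg _) zero_le_one).trans (by rw [mul_one])
    have e1 := mul_le_mul e0 hH (norm_nonneg _) zero_le_one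
    have e2 := mul_le_mul e1 hB (norm_nonneg _) (by rw [one_mul]; exact hX0)
    have e3 := mul_le_mul e2 hω (norm_nonneg _) (mul_nonneg (by rw [one_mul]; exact hX0) hK1)
    show ‖conj (x.ψ (D : ZMod x.p)) * (D : ℂ) ^ (-(1 - s)) * Hf (1 - s) * Bpoly χ x s * omegaW D s‖ ≤ M
    simp only [norm_mul, hMdef]
    rw [one_mul] at e3
    exact e3
  -- Cauchy's theorem between `𝔍(−1)` and `𝔍(0)`
  have hshift : ‖intJ D 0 F - intJ D (-1) F‖ ≤ ((0 : ℝ) - (-1)) * (M + M) := by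
    refine norm_intJ_sub_intJ_le D (by norm_num) hdiff (fun u hu => hM u hu _ rfl) fun u hu => ?_
    have e : (2 * π * t0 D - ell1 D : ℝ) = 2 * π * t0 D + -ell1 D := by ring
    rw [e]
    exact hM u hu _ (by ring)
  have hbud := side_budget hℓ64
  have h2M : ((0 : ℝ) - (-1)) * (M + M) ≤ 4 * Real.exp (1 / 4) * Cb * Real.exp (-(1 / 16) * ell D ^ 10) := by
    have e : ((0 : ℝ) - (-1)) * (M + M) = 4 * Real.exp (1 / 4) * Cb *
        ((⌊bigP D ^ 2⌋₊ : ℝ) ^ 4 * (⌈bigP D / bigT D ^ 2⌉₊ : ℝ) ^ 3 * Real.exp (-(ell D ^ 10 / 4))) := by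
      rw [hMdef]; ring
    rw [e]
    exact mul_le_mul_of_nonneg_left hbud (by positivity)
  calc ‖intJ D (-1) F‖ = ‖intJ D 0 F - (intJ D 0 F - intJ D (-1) F)‖ := by rw [sub_sub_cancel]
    _ ≤ ‖intJ D 0 F‖ + ‖intJ D 0 F - intJ D (-1) F‖ := norm_sub_le _ _
    _ ≤ absIntJ D 0 F + 4 * Real.exp (1 / 4) * Cb * Real.exp (-(1 / 16) * ell D ^ 10) :=
        add_le_add (norm_intJ_le_absIntJ D hL0 0 F) (hshift.trans h2M)

end Literature.NumberTheory.LFunctions.Zhang2022.Typed.Section15A.U009
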